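import Mathlib
import Literature.MathematicalPhysics.QuantumFieldTheory.Balaban1983to89.B12HjFree290
import Literature.MathematicalPhysics.QuantumFieldTheory.Balaban1983to89.B12WholeLattice290

/-!
# [B12, (3.5) p.271 + (4.36) p.290] The cubes □, □̃ⁿ, □₀ = □̃⁵ and supp ζ̃_□ ON THE LATTICE ℤᵈ: print's regions
instantiated in the extension bound (4.36) and in the y-extension over supp ζ̃_□ (satellite of `B12.lean`,
`B12Ext436Lattice.lean`, `B12HjFree290.lean`, `B12WholeLattice290.lean`)

T. Bałaban, *Renormalization group approach to lattice gauge field theories. I. Generation of effective actions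
in a small field approximation and a coupling constant renormalization in four dimensions*,
Comm. Math. Phys. **109** (1987) 249–301 (bib key `Balaban1987RG1`; in-tree module docstrings call it "B12").
Sub-cell B03 (§§2–5, pp. 264–301), fourteenth pass.  PDF page = journal page − 248.

## CITATION HEADER

* **[B12, p.257]** (PDF 9), the cubes and their enlargements: «We decompose the space T into the lattice of
  closed cubes of a size M, where M = Lᵐ, with centers at points of the lattice T_M^{(j+m)}. … We denote this
  family of cubes by π_j, and the cubes by □, □′, etc. For a cube □ ∈ π_j and n = 1, 2, … we define □̃ⁿ as a
  cube of the size (1 + 2n)M and with a center at the center of □. … The meaning of the symbol X̃ⁿ should be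
  obvious.»
* **[B12, p.270]** (PDF 22): «Let us take the partition π_k. We construct a cover of the space T by cubes □,
  which are unions of 2ᵈ neighbouring cubes from π_k. … Let us recall that we consider the continuous space T
  and all the cubes in the scale corresponding to the lattice T_η.»
* **[B12, (3.5) p.271]** (PDF 23): «We divide this sum into two subsums, assigning a term to one of them
  according to a position of its localization domain X with respect to □. The division is according to the
  conditions X∩(□̃²)ᶜ ≠ ∅, or X ⊂ □̃². (3.5)  Consider a domain X satisfying the first condition above.
  Assume that X ∈ 𝐃_j. There are two cases possible, either X∩□̃ = ∅, or X∩□̃ ≠ ∅. In the first case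
  dist(X, □) ≥ M, the distance is in the scale η, hence in the scale ξ dist^{(ξ)}(X, □) ≥ M(Lʲη)⁻¹. In the
  second case X is a big domain in ξ-scale, for example d_j(X) ≥ (Lʲη)⁻¹. Thus either the exponential decay
  of propagators corresponding to ξ-scale, or the exponential bound (1.18) should give a small factor
  O((Lʲη)ᴺ) with an arbitrary power N, enough to control the sums.»
* **[B12, p.273]** (PDF 25): «□₀ = □̃⁵»;  **[B12, p.274]** (PDF 26): «we remove from (3.19) a part of this
  expression localized outside □̃³. Take a function ζ̃_□ ∈ C₀^∞(□₀), ζ̃_□ = 1 on □̃³, ζ̃_□ = 0 outside □̃⁴.»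
* **[B12, p.290]** (PDF 42): «The sums over x above are restricted to supp δB ⊂ □, and the sums over y are
  restricted to supp B ⊂ supp ζ̃_□. … Next, we extend summations over y to the whole lattice Z⁴. The
  difference between the sum over supp ζ̃_□ and the sum over Z⁴ is a sum over a subset of (□̃³)ᶜ∩Z⁴. This
  gives again the exponentially small coefficients. Finally, the crucial step is an extension of the sum over
  localization domains X. … The expressions with localization domains, which do not satisfy this condition,
  are exponentially small in Lʲη, either because the domains are large, or because their distances to □ are
  large. We have analyzed it in Sect. 3. …  |Σ_{X∈𝐃⁰_j, X∩(□̃²)ᶜ≠∅} 𝐄⁽²⁾_{μ,ν}(X, x, y)| ≤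
  O(1)E₀ exp(−(Lʲη)⁻¹) exp(−δ₁|x − y|),  for x ∈ □,  (4.36)».

## WHAT IS TYPED HERE, AND WHY (gen-13 HANDOFF item (b7); cell DIVERGENCE D-b03.30 (ii) / D-b03.32)

The lineage proved (4.36) on the lattice ℤᵈ (`B12Ext436Lattice.ineq436_lattS` / `ineq436_latt`; the
(F)-reading difference `B12HjFree290.ineq436_latt_restr_sub`) and the y-extension tails of p.290
(`B12WholeLattice290.norm_tsum_sub_sum_shift_le`, `M0x/M1x/M2x_sub_sum_le_of_decay510`) with print's REGIONS
left ABSTRACT: a set of sites `Box` (□), a set `Outer` (the far region (□̃²)ᶜ) tied to it only through a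
separation hypothesis `hsep : ∀ x ∈ Box, ∀ q ∈ Outer, R ≤ dist x q`, a finite y-range `Y` tied to x only through
the ball condition `∀ y, |x − y|₁ < R → y ∈ Y`, and a free radius `R`.  This module supplies print's CONCRETE
regions on the site lattice ℤᵈ = the unit lattice of the ξ-scale (the lattice of `B12Ext436Lattice`, on which
a cube of π_j is the block `cubeOf M z` of M sites a side) and DISCHARGES those hypotheses, so that the
lineage's (4.36) and p.290 tails are now stated for □, (□̃²)ᶜ and supp ζ̃_□ themselves:

1. (§1, [folklore]) lattice boxes `Icc a b ⊆ ℤᵈ` (product order), the coordinate description of the sup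
   distance, sup ≤ ℓ¹, finiteness of boxes and of closed neighbourhoods of finite sets of sites, and **the
   lattice form of print's enlargement**: the closed sup-neighbourhood of integer radius k of the box [a, b] is
   the box [a − k, b + k] (`cthickening_box`) — p.257's «cube of the size (1 + 2n)M and with a center at the
   center of □» (k = nM for a cube of π_j), and «the meaning of the symbol X̃ⁿ should be obvious».
2. (§2) print's regions: □̃ⁿ := `Metric.cthickening (n·R₀) □`, the closed sup-neighbourhood, with the collar
   unit R₀ = M(Lʲη)⁻¹ = M·N sites (p.271: «dist(X, □) ≥ M, the distance is in the scale η, hence in the scale ξ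
   … ≥ M(Lʲη)⁻¹»; N := (Lʲη)⁻¹ = L^{k−j} ∈ ℕ); the chain □ ⊆ □̃ ⊆ □̃² ⊆ … ⊆ □̃⁵ = □₀; p.271's first case as the
   separation lemma «outside □̃ⁿ ⇒ at sup-distance > nR₀ from every site of □» (`lt_dist_of_not_mem_cthickening`),
   hence the lineage's `hsep` with R = 2R₀ for the far region (□̃²)ᶜ (`sep_sup`, `sep_l1`); p.271's second case
   in the typed diameter currency (`treeLen_ge_of_meets`: a domain meeting □̃ and (□̃²)ᶜ has M(d_j(X) + 3) > R₀).
3. (§3) **(4.36) for print's regions**: `ineq436_box` (sup reading, printed δ₁ = ½ min{δ₀, κ/M}), the rate form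
   `ineq436_box_rate` = [C_E e^{3Mδ₁} K₀ K₁ e^{(3/2)Mδ₁}] · e^{−(δ₁M)·N} · e^{−δ₁dist(x,y)}, the printed shape
   `ineq436_box_printed` (the factor exp(−(Lʲη)⁻¹) = e^{−N}, under the explicit restrictions δ₀M ≥ 2, κ ≥ 2,
   which make the rate δ₁M ≥ 1: `one_le_delta1_mul`), the ℓ¹ twin `ineq436_box_l1`, and the (F)-reading
   difference `ineq436_box_restr_sub`.
4. (§4) **S = supp ζ̃_□ ∩ ℤᵈ**: any set of sites with □̃³ ⊆ S ⊆ □̃⁴ (p.274) satisfies □ ⊆ S ⊆ □₀ = □̃⁵, is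
   finite when □ is, has Sᶜ ⊆ (□̃³)ᶜ (p.290 «a sum over a subset of (□̃³)ᶜ∩Z⁴»), and contains every site y
   with |x − y|₁ < 3R₀ for x ∈ □ — which DISCHARGES the ball condition of the p.290 tail lemmas with radius
   3R₀: `tail_suppZeta_le`, `M0x/M1x/M2x_suppZeta_le_of_decay510` (coefficient e^{−(δ₁/2)·3R₀}·S), and puts
   the x-range □ of (4.34) inside the y-range S for the (U)-reading difference `tsum_latt_sub_of_uniform_box`.

## DICTIONARY / DIVERGENCE (cell DIVERGENCE D-b03.33; the site model of D-b03.14 throughout)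

* SITE MODEL.  T «the continuous space» is modelled, as in the whole lattice lineage (D-b03.14), by the site
  lattice ℤᵈ in ξ-units: a cube of π_j is the block `cubeOf M z` of M sites a side; a cube of π_k has M·N
  sites a side, N = (Lʲη)⁻¹ = L^{k−j} ≥ 1 (a free natural number here; N = 1 is the case j = k); print's □
  (2ᵈ cubes of π_k) is a box of 2MN sites a side (`card_cube`); «X∩(□̃²)ᶜ ≠ ∅» reads «some site of some cube
  of X lies outside □̃²» (`B12Ext436Lattice.MeetsZ M (□̃²)ᶜ X`); dist^{(ξ)} is the sup distance of sites
  (print's |x − y| is Euclidean — D-b03.29: sup ≤ Euclidean ≤ ℓ¹, so each e^{−δ·dist_∞} bound implies print's).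
  The theorems are stated for an ARBITRARY set (or finite box) of sites □ and an arbitrary collar R₀ wherever
  the argument allows (print: R₀ = MN, □ a box of 2MN sites a side).
* □̃ⁿ := `Metric.cthickening (n·R₀) □` — for a box this IS print's concentric cube (`cthickening_box`); the
  far region of (4.36) is its complement `(cthickening (2R₀) □)ᶜ`, print's literal (□̃²)ᶜ∩ℤᵈ.  The larger
  far class cut by the OPEN neighbourhood, `(thickening (2R₀) □)ᶜ` (the boundary layer included), satisfies
  the same separation (`sep_sup_open`, `sep_l1_open`), so every capstone holds for it verbatim.
* p.271, second case: print says «for example d_j(X) ≥ (Lʲη)⁻¹»; the typed diameter lemma of the lineage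
  (`B12Decay510Lattice.dist_le_treeLen_sites`, slack + 3) gives M(d_j(X) + 3) > R₀, i.e. d_j(X) > N − 3 for
  R₀ = MN.  The capstones do not use the case split at all (the lineage's FarLeaf route, D-b03.30), so
  nothing depends on the offset; it is recorded, not repaired.
* (4.36)'s O(1) and rate, as in D-b03.30/32: print's O(1) is the displayed product C_E e^{3Mδ₁} K₀ K₁ e^{(3/2)Mδ₁}
  (C_E = 48√2·E₀/α₂² in the volume-leaf currency of `B12Ext436R1`; here C_E stays the parameter of the kernel
  bound `KernelBound`), and the printed rate exp(−(Lʲη)⁻¹) = e^{−N} needs δ₁M ≥ 1, typed as the explicit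
  restrictions δ₀M ≥ 2 ∧ κ ≥ 2 (print: M, κ «sufficiently large»).
* supp ζ̃_□ is ANY set S of sites with □̃³ ⊆ S ⊆ □̃⁴ (print fixes one smooth ζ̃_□; only its support enters
  the sums of p.290).

## NOT TYPED HERE, NOT CLAIMED

No new definition (the module is definition-free: `Set.Icc`, `Metric.cthickening` / `Metric.thickening`, the
lineage's `cubeOf`, `MeetsZ`, `LDom`, `KernelBound`, `ExpBound`, `Decay510`, `M0x/M1x/M2x`, `ofRealK` are reused
by name).  Not typed: the smooth functions ζ_□, ζ̃_□ themselves, the torus / finite-volume identification of T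
(ℤᵈ stands for T as in the whole lineage), (3.9), (1.18), the H_j(□₀) − H_j bound of p.290 (gen 13: a named
hypothesis only), the Euclidean metric.  Nothing here is progress on the summit
`Summit.QuantumFields.YangMillsMassGap`; the value is a kernel certificate that print's regions □, □̃ⁿ, □₀,
supp ζ̃_□ satisfy exactly the hypotheses under which the lineage proved (4.36) and the p.290 tails.
-/

namespace Literature.MathematicalPhysics.QuantumFieldTheory.Balaban1983to89.B12Cubes436

open Literature.MathematicalPhysics.QuantumFieldTheory.Balaban1983to89
open Literature.MathematicalPhysics.QuantumFieldTheory.GawedzkiKupiainen1985.PeriodicGleason (ExpBound pw)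
open Literature.MathematicalPhysics.QuantumFieldTheory.Balaban1983to89.B13ScaleTransfer (Pt)
open Literature.MathematicalPhysics.QuantumFieldTheory.Balaban1983to89.TreeLength (treeLen)
open Literature.MathematicalPhysics.QuantumFieldTheory.Balaban1983to89.B12TreeDecay (kappa₀ K₀ K₀_pos)
open Literature.MathematicalPhysics.QuantumFieldTheory.Balaban1983to89.B12Decay510 (mixedDeriv delta1)
open Literature.MathematicalPhysics.QuantumFieldTheory.Balaban1983to89.B12Decay510Window (K₁ K₁_nonneg)
open Literature.MathematicalPhysics.QuantumFieldTheory.Balaban1983to89.B12Decay510Lattice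
  (clampI distI cubeOf lo_le_clampI clampI_le_hi abs_sub_clampI dist_le_treeLen_sites)
open Literature.MathematicalPhysics.QuantumFieldTheory.Balaban1983to89.B12Sec2to5 (l1 l1_nonneg Decay510)
open Literature.MathematicalPhysics.QuantumFieldTheory.Balaban1983to89.B12Ext436Lattice
  (LDom MeetsZ geomZ geomZS ineq436_latt ineq436_lattS)
open Literature.MathematicalPhysics.QuantumFieldTheory.Balaban1983to89.B12HjFree290
  (ineq436_latt_restr_sub tsum_latt_sub_of_uniform)
open Literature.MathematicalPhysics.QuantumFieldTheory.Balaban1983to89.B12Moments443 (M0x M1x M2x)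
open Literature.MathematicalPhysics.QuantumFieldTheory.Balaban1983to89.B12Form543 (ofRealK)
open Literature.MathematicalPhysics.QuantumFieldTheory.Balaban1983to89.B12WholeLattice290
  (norm_tsum_sub_sum_shift_le M0x_sub_sum_le_of_decay510 M1x_sub_sum_le_of_decay510 M2x_sub_sum_le_of_decay510)
open Set Metric

variable {d : ℕ}

/-! ## 1. Lattice boxes of ℤᵈ, the sup distance coordinatewise, and neighbourhoods of boxes [folklore] -/

/-- Membership in a lattice box `[a, b] ∩ ℤᵈ = Set.Icc a b` (product order on ℤᵈ) is coordinatewise. [folklore] -/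
theorem mem_box {a b q : Pt d} : q ∈ Icc a b ↔ ∀ i, a i ≤ q i ∧ q i ≤ b i := by
  simp only [mem_Icc, Pi.le_def]
  exact ⟨fun h i => ⟨h.1 i, h.2 i⟩, fun h => ⟨fun i => (h i).1, fun i => (h i).2⟩⟩

/-- A lattice box is a finite set of sites. [folklore] -/
theorem finite_box (a b : Pt d) : (Icc a b).Finite := Set.finite_Icc a b

/-- The number of sites of a lattice box: ∏ᵢ #([aᵢ, bᵢ] ∩ ℤ). [folklore] -/
theorem card_box (a b : Pt d) : (Finset.Icc a b).card = ∏ i, (b i + 1 - a i).toNat := by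
  rw [Pi.card_Icc]
  exact Finset.prod_congr rfl fun i _ => Int.card_Icc _ _

/-- **print's □ = «unions of 2ᵈ neighbouring cubes from π_k»** counted in sites: the box of s sites a side has sᵈ
sites — for print's □, s = 2MN (a cube of π_k has MN ξ-sites a side, N = (Lʲη)⁻¹), sᵈ = 2ᵈ·(MN)ᵈ = 2ᵈ cubes of
π_k (site model, cell DIVERGENCE D-b03.14/33). [cite: Balaban1987RG1, p.270] -/
theorem card_cube (a : Pt d) (s : ℕ) : (Finset.Icc a (a + (((s : ℤ) - 1 : ℤ) : Pt d))).card = s ^ d := by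
  rw [card_box]
  have h : ∀ i, ((a + (((s : ℤ) - 1 : ℤ) : Pt d)) i + 1 - a i).toNat = s := fun i => by
    simp only [Pi.add_apply, Pi.intCast_apply, Int.cast_id]
    omega
  simp only [h, Finset.prod_const, Finset.card_univ, Fintype.card_fin]

/-- One coordinate of the sup distance of two sites of ℤᵈ: |xᵢ − qᵢ| ≤ dist(x, q). [folklore] -/
theorem abs_sub_le_dist (x q : Pt d) (i : Fin d) : (((|x i - q i| : ℤ)) : ℝ) ≤ dist x q := by
  have h := dist_le_pi_dist x q i
  rw [Int.dist_eq] at h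
  push_cast
  exact h

/-- The sup distance of two sites of ℤᵈ coordinatewise: dist(x, q) ≤ r iff |xᵢ − qᵢ| ≤ r for all i (r ≥ 0). [folklore] -/
theorem dist_le_iff_coord {x q : Pt d} {r : ℝ} (hr : 0 ≤ r) :
    dist x q ≤ r ↔ ∀ i, (((|x i - q i| : ℤ)) : ℝ) ≤ r := by
  rw [dist_pi_le_iff hr]
  refine forall_congr' fun i => ?_
  rw [Int.dist_eq]
  push_cast
  exact Iff.rfl

/-- **sup ≤ ℓ¹** on ℤᵈ: dist(x, q) ≤ |x − q|₁ (the comparison behind D-b03.29: every bound decaying in the sup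
distance at rate δ implies the same bound in print's Euclidean and in the ℓ¹ distance). [folklore] -/
theorem dist_le_l1 (x q : Pt d) : dist x q ≤ l1 (x - q) := by
  refine (dist_pi_le_iff (l1_nonneg _)).2 fun i => ?_
  rw [Int.dist_eq]
  calc |((x i : ℤ) : ℝ) - ((q i : ℤ) : ℝ)| = |(((x - q) i : ℤ) : ℝ)| := by
        simp only [Pi.sub_apply, Int.cast_sub]
    _ ≤ ∑ μ, |(((x - q) μ : ℤ) : ℝ)| :=
        Finset.single_le_sum (f := fun μ => |(((x - q) μ : ℤ) : ℝ)|) (fun μ _ => abs_nonneg _)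
          (Finset.mem_univ i)
    _ = l1 (x - q) := rfl

/-- A closed sup-ball of ℤᵈ lies in a lattice box: closedBall(x, r) ⊆ [x − ⌈r⌉, x + ⌈r⌉]. [folklore] -/
theorem closedBall_subset_box (x : Pt d) (r : ℝ) :
    closedBall x r ⊆ Icc (x - ((⌈r⌉₊ : ℕ) : Pt d)) (x + ((⌈r⌉₊ : ℕ) : Pt d)) := by
  intro q hq
  rw [mem_closedBall] at hq
  rw [mem_box]
  intro i
  have h1 : (((|q i - x i| : ℤ)) : ℝ) ≤ ((⌈r⌉₊ : ℕ) : ℝ) := ((abs_sub_le_dist q x i).trans hq).trans (Nat.le_ceil r)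
  have h2 : |q i - x i| ≤ ((⌈r⌉₊ : ℕ) : ℤ) := by exact_mod_cast h1
  rw [abs_le] at h2
  simp only [Pi.sub_apply, Pi.add_apply, Pi.natCast_apply]
  omega

/-- From inside the closed r-neighbourhood of a FINITE set of sites one reaches the set within sup-distance r
(a finite set is compact, so `cthickening r B = ⋃_{p∈B} closedBall(p, r)`). [folklore] -/
theorem exists_mem_dist_le {B : Set (Pt d)} (hB : B.Finite) {r : ℝ} (hr : 0 ≤ r) {q : Pt d}
    (hq : q ∈ cthickening r B) : ∃ p ∈ B, dist q p ≤ r := by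
  rw [hB.isCompact.cthickening_eq_biUnion_closedBall hr] at hq
  obtain ⟨p, hp, hqp⟩ := mem_iUnion₂.1 hq
  exact ⟨p, hp, mem_closedBall.1 hqp⟩

/-- The closed neighbourhood of a finite set of sites is finite (so □̃ⁿ, □₀ and supp ζ̃_□ ∩ ℤᵈ are finite sets of
sites when □ is). [folklore] -/
theorem finite_cthickening {B : Set (Pt d)} (hB : B.Finite) {r : ℝ} (hr : 0 ≤ r) : (cthickening r B).Finite := by
  rw [hB.isCompact.cthickening_eq_biUnion_closedBall hr]
  exact hB.biUnion fun x _ => (finite_box _ _).subset (closedBall_subset_box x r)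

/-- **The lattice form of print's enlargement □ ↦ □̃ⁿ**: the closed sup-neighbourhood of integer radius k of the
box [a, b] ∩ ℤᵈ (a ≤ b) is the concentric box [a − k, b + k] ∩ ℤᵈ — «□̃ⁿ as a cube of the size (1 + 2n)M and
with a center at the center of □» (k = nM for a cube of π_j of M sites a side; k = nMN for print's □ of §3),
and «the meaning of the symbol X̃ⁿ should be obvious». [cite: Balaban1987RG1, p.257] -/
theorem cthickening_box {a b : Pt d} (hab : a ≤ b) (k : ℕ) :
    cthickening (k : ℝ) (Icc a b) = Icc (a - (k : Pt d)) (b + (k : Pt d)) := by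
  have hab' : ∀ i, a i ≤ b i := fun i => hab i
  ext q
  refine ⟨fun hq => ?_, fun hq => ?_⟩
  · obtain ⟨p, hp, hqp⟩ := exists_mem_dist_le (finite_box a b) (Nat.cast_nonneg k) hq
    rw [mem_box] at hp ⊢
    intro i
    obtain ⟨hp1, hp2⟩ := hp i
    have h1 : (((|q i - p i| : ℤ)) : ℝ) ≤ (k : ℝ) := (abs_sub_le_dist q p i).trans hqp
    have h2 : |q i - p i| ≤ (k : ℤ) := by exact_mod_cast h1
    rw [abs_le] at h2
    simp only [Pi.sub_apply, Pi.add_apply, Pi.natCast_apply]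
    omega
  · rw [mem_box] at hq
    refine mem_cthickening_of_dist_le q (fun i => clampI (a i) (b i) (q i)) (k : ℝ) (Icc a b)
      (mem_box.2 fun i => ⟨lo_le_clampI _ _ _, clampI_le_hi (hab' i) _⟩)
      ((dist_le_iff_coord (Nat.cast_nonneg k)).2 fun i => ?_)
    have h := hq i
    simp only [Pi.sub_apply, Pi.add_apply, Pi.natCast_apply] at h
    have h3 : |q i - clampI (a i) (b i) (q i)| ≤ (k : ℤ) := by
      rw [abs_sub_clampI (hab' i)]
      unfold distI
      omega
    exact_mod_cast h3

/-! ## 2. Print's regions □ ⊆ □̃ ⊆ □̃² ⊆ … ⊆ □̃⁵ = □₀ and the far region (□̃²)ᶜ; the two cases of p.271 -/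

/-- **Outside the closed r-neighbourhood means strictly r-separated from every site of the set** — the
mechanism of p.271's first case «X∩□̃ = ∅ … dist(X, □) ≥ M»: q ∉ □̃-type neighbourhood of radius r of B, x ∈ B ⇒
r < dist(x, q).  (Any pseudo-metric space.) [folklore] -/
theorem lt_dist_of_not_mem_cthickening {α : Type*} [PseudoMetricSpace α] {B : Set α} {r : ℝ} {q : α}
    (hq : q ∉ cthickening r B) {x : α} (hx : x ∈ B) : r < dist x q := by
  by_contra h
  exact hq (mem_cthickening_of_dist_le q x r B hx (by rw [dist_comm]; exact not_lt.1 h))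

/-- The open-neighbourhood version: q ∉ thickening r B, x ∈ B ⇒ r ≤ dist(x, q). [folklore] -/
theorem le_dist_of_not_mem_thickening {α : Type*} [PseudoMetricSpace α] {B : Set α} {r : ℝ} {q : α}
    (hq : q ∉ thickening r B) {x : α} (hx : x ∈ B) : r ≤ dist x q := by
  by_contra h
  exact hq (mem_thickening_iff.2 ⟨x, hx, by rw [dist_comm]; exact not_le.1 h⟩)

/-- □ ⊆ □̃ⁿ: a set lies in each of its closed neighbourhoods. [cite: Balaban1987RG1, p.257] -/
theorem self_subset_tilde (B : Set (Pt d)) (r : ℝ) : B ⊆ cthickening r B :=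
  self_subset_cthickening B

/-- □̃ⁿ ⊆ □̃ᵐ for n ≤ m (collar unit R₀ ≥ 0): the chain □̃ ⊆ □̃² ⊆ □̃³ ⊆ □̃⁴ ⊆ □̃⁵ = □₀ of pp. 271–274.
[cite: Balaban1987RG1, p.257 and p.273] -/
theorem tilde_mono (B : Set (Pt d)) {R₀ : ℝ} (hR₀ : 0 ≤ R₀) {n m : ℝ} (h : n ≤ m) :
    cthickening (n * R₀) B ⊆ cthickening (m * R₀) B :=
  cthickening_mono (mul_le_mul_of_nonneg_right h hR₀) B

/-- **p.271, first case, for the far region of (3.5)/(4.36)** — the separation hypothesis `hsep` of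
`B12Ext436Lattice.ineq436_lattS` DISCHARGED (sup reading): for x ∈ □ and q ∈ (□̃²)ᶜ = the complement of the
closed 2R₀-neighbourhood of □ (R₀ = M(Lʲη)⁻¹ sites), 2R₀ ≤ dist_∞(x, q).  Stated for any set □ and radius r.
[cite: Balaban1987RG1, (3.5) p.271] -/
theorem sep_sup (B : Set (Pt d)) (r : ℝ) : ∀ x ∈ B, ∀ q ∈ (cthickening r B)ᶜ, r ≤ dist x q :=
  fun _ hx _ hq => (lt_dist_of_not_mem_cthickening hq hx).le

/-- The same separation in the ℓ¹ reading of `B12Ext436Lattice.ineq436_latt` (sup ≤ ℓ¹). [cite: Balaban1987RG1, (3.5) p.271] -/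
theorem sep_l1 (B : Set (Pt d)) (r : ℝ) : ∀ x ∈ B, ∀ q ∈ (cthickening r B)ᶜ, r ≤ l1 (x - q) :=
  fun x hx q hq => (sep_sup B r x hx q hq).trans (dist_le_l1 x q)

/-- The separation for the LARGER far class cut by the open neighbourhood, `(thickening r □)ᶜ` (boundary layer
included): still r ≤ dist_∞(x, q) — so every capstone of §3 holds verbatim for it. [folklore] -/
theorem sep_sup_open (B : Set (Pt d)) (r : ℝ) : ∀ x ∈ B, ∀ q ∈ (thickening r B)ᶜ, r ≤ dist x q :=
  fun _ hx _ hq => le_dist_of_not_mem_thickening hq hx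

/-- ℓ¹ form of `sep_sup_open`. [folklore] -/
theorem sep_l1_open (B : Set (Pt d)) (r : ℝ) : ∀ x ∈ B, ∀ q ∈ (thickening r B)ᶜ, r ≤ l1 (x - q) :=
  fun x hx q hq => (sep_sup_open B r x hx q hq).trans (dist_le_l1 x q)

/-- The far class «X∩Outer ≠ ∅» (`MeetsZ`) is monotone in the far region. [folklore] -/
theorem meetsZ_mono {M : ℕ} {O O' : Set (Pt d)} (h : O ⊆ O') {X : LDom d} (hX : MeetsZ M O X) :
    MeetsZ M O' X := by
  obtain ⟨q, hq, hqO⟩ := hX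
  exact ⟨q, hq, h hqO⟩

/-- Print's far region (□̃²)ᶜ (closed cube removed) lies in the far region cut by the open neighbourhood. [folklore] -/
theorem far_closed_subset_far_open (B : Set (Pt d)) (r : ℝ) : (cthickening r B)ᶜ ⊆ (thickening r B)ᶜ :=
  compl_subset_compl.2 (thickening_subset_cthickening r B)

/-- **p.271, second case** «or X∩□̃ ≠ ∅. … In the second case X is a big domain in ξ-scale, for example
d_j(X) ≥ (Lʲη)⁻¹», in the typed diameter currency: if a localization domain X of the ξ-lattice (a face-connected
union of M-blocks of sites, `LDom`) has a site q₁ of one of its cubes in □̃ = the closed R₀-neighbourhood of the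
finite set □ and a site q₂ of one of its cubes in the far region (□̃²)ᶜ, then R₀ < dist_∞(q₁, q₂) ≤ M(d_j(X) + 3)
(`B12Decay510Lattice.dist_le_treeLen_sites`), i.e. d_j(X) > N − 3 for R₀ = MN (print: «for example ≥ N»; the
offset is the slack of the typed diameter lemma — DICTIONARY; the capstones of §3 do not use this case split).
[cite: Balaban1987RG1, (3.5) p.271] -/
theorem treeLen_ge_of_meets {M : ℕ} (hM : 0 < M) {B : Set (Pt d)} (hB : B.Finite) {R₀ : ℝ} (hR₀ : 0 ≤ R₀)
    (X : LDom d) {q₁ q₂ : Pt d} (h₁ : cubeOf M q₁ ∈ X.1) (h₁' : q₁ ∈ cthickening R₀ B)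
    (h₂ : cubeOf M q₂ ∈ X.1) (h₂' : q₂ ∈ (cthickening (2 * R₀) B)ᶜ) :
    R₀ < (M : ℝ) * (treeLen X.1 + 3) := by
  obtain ⟨x, hx, hx₁⟩ := exists_mem_dist_le hB hR₀ h₁'
  have h2 : 2 * R₀ < dist x q₂ := lt_dist_of_not_mem_cthickening h₂' hx
  have htri : dist x q₂ ≤ dist x q₁ + dist q₁ q₂ := dist_triangle x q₁ q₂
  have hd : dist q₁ q₂ ≤ (M : ℝ) * (treeLen X.1 + 3) := dist_le_treeLen_sites hM X.2.1 X.2.2 h₁ h₂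
  rw [dist_comm] at hx₁
  linarith

/-! ## 3. (4.36) for print's regions: x ∈ □, the far class {X : X∩(□̃²)ᶜ ≠ ∅} -/

/-- **(4.36) FOR PRINT'S REGIONS, sup reading, printed δ₁ = ½ min{δ₀, κM⁻¹}**: on the lattice ℤᵈ (cubes of π_j of
M ≥ 1 sites, d ≥ 1), for any set of sites □, any collar R₀, a kernel 𝐄² obeying the (4.4)/(1.18)-type bound
`KernelBound` (sup lattice distances) with δ₀ > 0, κ ≥ 4κ₀(4·2ᵈ, 2d), and x ∈ □: the terms over the far class
{X : some site of a cube of X lies in (□̃²)ᶜ}, □̃² = the closed 2R₀-neighbourhood of □, are summable and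
|Σ_{X∩(□̃²)ᶜ≠∅} 𝐄²(X, x, y)| ≤ C_E e^{3Mδ₁} K₀(4·2ᵈ, 2d) K₁(d, δ₀/(4d)) e^{−(δ₁/2)(2R₀ − 3M)} e^{−δ₁dist_∞(x,y)}
(`B12Ext436Lattice.ineq436_lattS` with its separation hypothesis discharged by `sep_sup`).
[cite: Balaban1987RG1, (4.36) p.290] -/
theorem ineq436_box (hd : 0 < d) {M : ℕ} (hM : 0 < M) {E2 : LDom d → Pt d → Pt d → ℝ} {CE κ δ₀ R₀ : ℝ}
    {B : Set (Pt d)} (hCE : 0 ≤ CE) (hδ₀ : 0 < δ₀) (hκ₀ : kappa₀ (4 * 2 ^ d) (2 * d) ≤ κ / 4)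
    (hE : (geomZS d M).KernelBound E2 CE κ δ₀) {x : Pt d} (hx : x ∈ B) (y : Pt d) :
    Summable (fun X : {X : LDom d // MeetsZ M (cthickening (2 * R₀) B)ᶜ X} => E2 X.1 x y) ∧
    |∑' X : {X : LDom d // MeetsZ M (cthickening (2 * R₀) B)ᶜ X}, E2 X.1 x y| ≤
      CE * Real.exp (delta1 δ₀ κ M * M * 3) * K₀ (4 * 2 ^ d) (2 * d) * K₁ d (δ₀ / 4 / d) *
        Real.exp (-(delta1 δ₀ κ M / 2) * (2 * R₀ - (M : ℝ) * 3)) *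
        Real.exp (-(delta1 δ₀ κ M) * dist x y) :=
  ineq436_lattS hd hM hCE hδ₀ hκ₀ hE (sep_sup B (2 * R₀)) hx y

/-- **(4.36) for print's regions with the rate in N = (Lʲη)⁻¹ displayed**: with print's collar R₀ = MN
(M(Lʲη)⁻¹ ξ-sites), e^{−(δ₁/2)(2MN − 3M)} = e^{(3/2)Mδ₁} · e^{−(δ₁M)·N}, so for x ∈ □
|Σ_{X∩(□̃²)ᶜ≠∅} 𝐄²(X, x, y)| ≤ [C_E e^{3Mδ₁} K₀ K₁ e^{(3/2)Mδ₁}] · e^{−(δ₁M)N} · e^{−δ₁dist_∞(x,y)}.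
[cite: Balaban1987RG1, (4.36) p.290] -/
theorem ineq436_box_rate (hd : 0 < d) {M N : ℕ} (hM : 0 < M) {E2 : LDom d → Pt d → Pt d → ℝ} {CE κ δ₀ : ℝ}
    {B : Set (Pt d)} (hCE : 0 ≤ CE) (hδ₀ : 0 < δ₀) (hκ₀ : kappa₀ (4 * 2 ^ d) (2 * d) ≤ κ / 4)
    (hE : (geomZS d M).KernelBound E2 CE κ δ₀) {x : Pt d} (hx : x ∈ B) (y : Pt d) :
    |∑' X : {X : LDom d // MeetsZ M (cthickening (2 * ((M : ℝ) * N)) B)ᶜ X}, E2 X.1 x y| ≤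
      CE * Real.exp (delta1 δ₀ κ M * M * 3) * K₀ (4 * 2 ^ d) (2 * d) * K₁ d (δ₀ / 4 / d) *
        Real.exp (delta1 δ₀ κ M * M * (3 / 2)) * Real.exp (-(delta1 δ₀ κ M * M) * N) *
        Real.exp (-(delta1 δ₀ κ M) * dist x y) := by
  have h := (ineq436_box hd hM hCE hδ₀ hκ₀ hE hx y (R₀ := (M : ℝ) * N)).2
  have heq : Real.exp (-(delta1 δ₀ κ M / 2) * (2 * ((M : ℝ) * N) - (M : ℝ) * 3)) =
      Real.exp (delta1 δ₀ κ M * M * (3 / 2)) * Real.exp (-(delta1 δ₀ κ M * M) * N) := by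
    rw [← Real.exp_add]
    congr 1
    ring
  rw [heq] at h
  simpa only [mul_assoc] using h

/-- The rate δ₁M = ½ min{δ₀M, κ} of (4.36) in N = (Lʲη)⁻¹ is at least the printed 1 under the explicit
restrictions δ₀M ≥ 2 and κ ≥ 2 (print: M and κ «sufficiently large»). [folklore] -/
theorem one_le_delta1_mul {δ₀ κ M : ℝ} (hM : 0 < M) (h1 : 2 ≤ δ₀ * M) (h2 : 2 ≤ κ) :
    1 ≤ delta1 δ₀ κ M * M := by
  unfold delta1
  rcases min_cases δ₀ (κ / M) with ⟨h, _⟩ | ⟨h, _⟩ <;> rw [h]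
  · have : δ₀ / 2 * M = δ₀ * M / 2 := by ring
    rw [this]
    linarith
  · have : κ / M / 2 * M = κ / 2 := by field_simp
    rw [this]
    linarith

/-- **(4.36) IN THE PRINTED SHAPE for print's regions** «≤ O(1)E₀ exp(−(Lʲη)⁻¹) exp(−δ₁|x − y|), for x ∈ □»:
with □̃² the closed 2MN-neighbourhood of □ (N = (Lʲη)⁻¹), under the explicit restrictions δ₀M ≥ 2, κ ≥ 2 (and
κ ≥ 4κ₀(4·2ᵈ, 2d), δ₀ > 0), for x ∈ □:
|Σ_{X∩(□̃²)ᶜ≠∅} 𝐄²(X, x, y)| ≤ [C_E e^{3Mδ₁} K₀(4·2ᵈ, 2d) K₁(d, δ₀/(4d)) e^{(3/2)Mδ₁}] · e^{−N} · e^{−δ₁dist_∞(x,y)}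
— print's O(1)E₀ is the bracket (cell DIVERGENCE D-b03.30/33). [cite: Balaban1987RG1, (4.36) p.290] -/
theorem ineq436_box_printed (hd : 0 < d) {M N : ℕ} (hM : 0 < M) {E2 : LDom d → Pt d → Pt d → ℝ}
    {CE κ δ₀ : ℝ} {B : Set (Pt d)} (hCE : 0 ≤ CE) (hδ₀ : 0 < δ₀) (hκ₀ : kappa₀ (4 * 2 ^ d) (2 * d) ≤ κ / 4)
    (hδ₀M : 2 ≤ δ₀ * M) (hκ2 : 2 ≤ κ) (hE : (geomZS d M).KernelBound E2 CE κ δ₀) {x : Pt d} (hx : x ∈ B)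
    (y : Pt d) :
    |∑' X : {X : LDom d // MeetsZ M (cthickening (2 * ((M : ℝ) * N)) B)ᶜ X}, E2 X.1 x y| ≤
      CE * Real.exp (delta1 δ₀ κ M * M * 3) * K₀ (4 * 2 ^ d) (2 * d) * K₁ d (δ₀ / 4 / d) *
        Real.exp (delta1 δ₀ κ M * M * (3 / 2)) * Real.exp (-(N : ℝ)) *
        Real.exp (-(delta1 δ₀ κ M) * dist x y) := by
  refine (ineq436_box_rate hd hM hCE hδ₀ hκ₀ hE hx y (N := N)).trans ?_
  have hc : 0 ≤ CE * Real.exp (delta1 δ₀ κ M * M * 3) * K₀ (4 * 2 ^ d) (2 * d) * K₁ d (δ₀ / 4 / d) *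
      Real.exp (delta1 δ₀ κ M * M * (3 / 2)) :=
    mul_nonneg (mul_nonneg (mul_nonneg (mul_nonneg hCE (Real.exp_nonneg _)) (K₀_pos _ _).le)
      (K₁_nonneg _ _)) (Real.exp_nonneg _)
  have hN : Real.exp (-(delta1 δ₀ κ M * M) * N) ≤ Real.exp (-(N : ℝ)) := by
    apply Real.exp_le_exp.2
    have h1 := one_le_delta1_mul (Nat.cast_pos.2 hM) hδ₀M hκ2
    have hN0 : (0 : ℝ) ≤ N := Nat.cast_nonneg N
    nlinarith
  exact mul_le_mul_of_nonneg_right (mul_le_mul_of_nonneg_left hN hc) (Real.exp_nonneg _)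

/-- **(4.36) for print's regions, ℓ¹ reading** (`B12Ext436Lattice.ineq436_latt`, δ₁ = ½ min{δ₀, κ(Md)⁻¹}, its
separation hypothesis discharged by `sep_l1`): for x ∈ □,
|Σ_{X∩(□̃²)ᶜ≠∅} 𝐄²(X, x, y)| ≤ C_E e^{3Mdδ₁} K₀(4·2ᵈ, 2d) K₁(d, δ₀/4) e^{−(δ₁/2)(2R₀ − 3Md)} e^{−δ₁|x − y|₁}.
[cite: Balaban1987RG1, (4.36) p.290] -/
theorem ineq436_box_l1 (hd : 0 < d) {M : ℕ} (hM : 0 < M) {E2 : LDom d → Pt d → Pt d → ℝ} {CE κ δ₀ R₀ : ℝ}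
    {B : Set (Pt d)} (hCE : 0 ≤ CE) (hδ₀ : 0 < δ₀) (hκ₀ : kappa₀ (4 * 2 ^ d) (2 * d) ≤ κ / 4)
    (hE : (geomZ d M).KernelBound E2 CE κ δ₀) {x : Pt d} (hx : x ∈ B) (y : Pt d) :
    Summable (fun X : {X : LDom d // MeetsZ M (cthickening (2 * R₀) B)ᶜ X} => E2 X.1 x y) ∧
    |∑' X : {X : LDom d // MeetsZ M (cthickening (2 * R₀) B)ᶜ X}, E2 X.1 x y| ≤
      CE * Real.exp (delta1 δ₀ κ ((M : ℝ) * d) * ((M : ℝ) * d) * 3) * K₀ (4 * 2 ^ d) (2 * d) * K₁ d (δ₀ / 4) *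
        Real.exp (-(delta1 δ₀ κ ((M : ℝ) * d) / 2) * (2 * R₀ - (M : ℝ) * d * 3)) *
        Real.exp (-(delta1 δ₀ κ ((M : ℝ) * d)) * l1 (x - y)) :=
  ineq436_latt hd hM hCE hδ₀ hκ₀ hE (sep_l1 B (2 * R₀)) hx y

section Replacement

variable {W : Type*} [NormedAddCommGroup W] [NormedSpace ℂ W]

/-- **The (4.36)-type far sum of the H_j(□₀) → H_j replacement for print's regions, READING (F)**
(`B12HjFree290.ineq436_latt_restr_sub` with its separation hypothesis discharged by `sep_l1`): for x ∈ □ the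
replacement terms over {X : X∩(□̃²)ᶜ ≠ ∅} are summable and
|Σ′| ≤ 8E₀α₂⁻²B₃η e^{3Mdδ₁} K₀(4·2ᵈ, 2d) K₁(d, δ₀/4) e^{−(δ₁/2)(2R₀ − 3Md)} e^{−δ₁|x − y|₁}.
[cite: Balaban1987RG1, (4.36) p.290] -/
theorem ineq436_box_restr_sub (hd : 0 < d) {M : ℕ} (hM : 0 < M) (EX : LDom d → W → ℂ)
    (h₀ h : LDom d → Pt d → W) (E2₀ E2 : LDom d → Pt d → Pt d → ℝ) {S : Set (Pt d)}
    {α₂ E₀ B₃ η κ δ₀ R₀ : ℝ} {B : Set (Pt d)} (hα₂ : 0 < α₂) (hE₀ : 0 ≤ E₀) (hB₃ : 0 ≤ B₃) (hη : 0 ≤ η)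
    (hδ₀ : 0 < δ₀) (hκ₀ : kappa₀ (4 * 2 ^ d) (2 * d) ≤ κ / 4)
    (han : ∀ X, AnalyticOnNhd ℂ (EX X) (ball 0 α₂))
    (h118 : ∀ X, ∀ v ∈ ball (0 : W) α₂, ‖EX X v‖ ≤ E₀ * Real.exp (-κ * treeLen X.1))
    (hrepr₀ : ∀ X x y, E2₀ X x y = (mixedDeriv (EX X) (h₀ X x) (h₀ X y)).re)
    (hrepr : ∀ X x y, E2 X x y = (mixedDeriv (EX X) (h X x) (h X y)).re)
    (hh₀ : ∀ X x, ‖h₀ X x‖ ≤ B₃ * Real.exp (-δ₀ * (geomZ d M).distD x X))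
    (hh : ∀ X x, ‖h X x‖ ≤ B₃ * Real.exp (-δ₀ * (geomZ d M).distD x X))
    (hdiff : ∀ X, ∀ x ∈ S, ‖h₀ X x - h X x‖ ≤ η * Real.exp (-δ₀ * (geomZ d M).distD x X))
    {x : Pt d} (hx : x ∈ B) (y : Pt d) :
    Summable (fun X : {X : LDom d // MeetsZ M (cthickening (2 * R₀) B)ᶜ X} =>
      (S ×ˢ S).indicator (fun p : Pt d × Pt d => E2₀ X.1 p.1 p.2 - E2 X.1 p.1 p.2) (x, y)) ∧
    |∑' X : {X : LDom d // MeetsZ M (cthickening (2 * R₀) B)ᶜ X},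
        (S ×ˢ S).indicator (fun p : Pt d × Pt d => E2₀ X.1 p.1 p.2 - E2 X.1 p.1 p.2) (x, y)| ≤
      8 * E₀ / α₂ ^ 2 * B₃ * η * Real.exp (delta1 δ₀ κ ((M : ℝ) * d) * ((M : ℝ) * d) * 3) *
        K₀ (4 * 2 ^ d) (2 * d) * K₁ d (δ₀ / 4) *
        Real.exp (-(delta1 δ₀ κ ((M : ℝ) * d) / 2) * (2 * R₀ - (M : ℝ) * d * 3)) *
        Real.exp (-(delta1 δ₀ κ ((M : ℝ) * d)) * l1 (x - y)) :=
  ineq436_latt_restr_sub hd hM EX h₀ h E2₀ E2 hα₂ hE₀ hB₃ hη hδ₀ hκ₀ han h118 hrepr₀ hrepr hh₀ hh hdiff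
    (sep_l1 B (2 * R₀)) hx y

end Replacement

/-! ## 4. S = supp ζ̃_□ ∩ ℤᵈ: □ ⊆ □̃³ ⊆ S ⊆ □̃⁴ ⊆ □̃⁵ = □₀, and the y-extension of p.290 over S -/

/-- **«supp δB ⊂ □ … supp B ⊂ supp ζ̃_□»** (p.290) with «ζ̃_□ = 1 on □̃³» (p.274): □ ⊆ □̃³ ⊆ S — the x-range
of (4.34) lies inside the y-range. [cite: Balaban1987RG1, p.274 and p.290] -/
theorem box_subset_suppZeta {B S : Set (Pt d)} {R₀ : ℝ} (h3 : cthickening (3 * R₀) B ⊆ S) : B ⊆ S :=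
  (self_subset_cthickening B).trans h3

/-- **«ζ̃_□ ∈ C₀^∞(□₀) … ζ̃_□ = 0 outside □̃⁴»** (p.274) with «□₀ = □̃⁵» (p.273): S ⊆ □̃⁴ ⊆ □̃⁵ = □₀ (R₀ ≥ 0).
[cite: Balaban1987RG1, p.273 and p.274] -/
theorem suppZeta_subset_box0 {B S : Set (Pt d)} {R₀ : ℝ} (hR₀ : 0 ≤ R₀) (h4 : S ⊆ cthickening (4 * R₀) B) :
    S ⊆ cthickening (5 * R₀) B :=
  h4.trans (cthickening_mono (by linarith) B)

/-- supp ζ̃_□ ∩ ℤᵈ is a finite set of sites when □ is (S ⊆ □̃⁴, `finite_cthickening`). [folklore] -/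
theorem finite_suppZeta {B S : Set (Pt d)} (hB : B.Finite) {R₀ : ℝ} (hR₀ : 0 ≤ R₀)
    (h4 : S ⊆ cthickening (4 * R₀) B) : S.Finite :=
  (finite_cthickening hB (by positivity)).subset h4

/-- **«The difference between the sum over supp ζ̃_□ and the sum over Z⁴ is a sum over a subset of (□̃³)ᶜ∩Z⁴»**:
Sᶜ ⊆ (□̃³)ᶜ. [cite: Balaban1987RG1, p.290] -/
theorem compl_suppZeta_subset {B S : Set (Pt d)} {R₀ : ℝ} (h3 : cthickening (3 * R₀) B ⊆ S) :
    Sᶜ ⊆ (cthickening (3 * R₀) B)ᶜ :=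
  compl_subset_compl.2 h3

/-- **The ball condition of the p.290 tail lemmas of `B12WholeLattice290` DISCHARGED**: for x ∈ □, every site y
with |x − y|₁ < 3R₀ lies in □̃³ ⊆ S (sup ≤ ℓ¹). [cite: Balaban1987RG1, p.274 and p.290] -/
theorem mem_suppZeta_of_l1_lt {B S : Set (Pt d)} {R₀ : ℝ} (h3 : cthickening (3 * R₀) B ⊆ S) {x : Pt d}
    (hx : x ∈ B) {y : Pt d} (hy : l1 (x - y) < 3 * R₀) : y ∈ S :=
  h3 (mem_cthickening_of_dist_le y x (3 * R₀) B hx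
    (by rw [dist_comm]; exact (dist_le_l1 x y).trans hy.le))

/-- **p.290 «Next, we extend summations over y to the whole lattice Z⁴ … This gives again the exponentially small
coefficients» FOR PRINT'S REGIONS**: for a kernel c with |c(z)| ≤ M_c e^{−a|z|₁} (a > 0), a weight F of polynomial
growth ‖F‖ ≤ K·pw_p, x ∈ □ and the finite y-range S = supp ζ̃_□ ∩ ℤᵈ ⊇ □̃³ (collar unit R₀; print R₀ = M(Lʲη)⁻¹):
‖Σ_{y∈ℤᵈ} c(x − y)F(x − y) − Σ_{y∈S} c(x − y)F(x − y)‖ ≤ M_c K e^{−(a/2)·3R₀} S_{a/2,p,d}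
(`B12WholeLattice290.norm_tsum_sub_sum_shift_le`, its free radius := 3R₀, its ball condition by
`mem_suppZeta_of_l1_lt`). [cite: Balaban1987RG1, p.290] -/
theorem tail_suppZeta_le {a Mc : ℝ} (ha : 0 < a) {c : Pt d → ℂ} (hc : ExpBound a Mc c)
    {F : Pt d → ℂ} {K : ℝ} {p : ℕ} (hK : 0 ≤ K) (hF : ∀ n, ‖F n‖ ≤ K * pw p n)
    {B : Set (Pt d)} {R₀ : ℝ} (SF : Finset (Pt d)) (h3 : cthickening (3 * R₀) B ⊆ ↑SF) {x : Pt d}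
    (hx : x ∈ B) :
    ‖∑' y, c (x - y) * F (x - y) - ∑ y ∈ SF, c (x - y) * F (x - y)‖ ≤
      Mc * K * Real.exp (-(a / 2) * (3 * R₀)) * B12WholeLattice290.S (a / 2) p d :=
  norm_tsum_sub_sum_shift_le ha hc hK hF x (3 * R₀) SF
    fun _ hy => Finset.mem_coe.1 (mem_suppZeta_of_l1_lt h3 hx hy)

/-- **p.290 for the zeroth moments of a (5.10) kernel, print's regions**: |Π_{μν}(z)| ≤ C₁e^{−δ₁|z|₁} (δ₁ > 0),
x ∈ □, S = supp ζ̃_□ ∩ ℤᵈ ⊇ □̃³ finite: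
‖Σ_{y∈ℤᵈ} Π_{μν}(x − y) − Σ_{y∈S} Π_{μν}(x − y)‖ ≤ C₁ e^{−(δ₁/2)·3R₀} S_{δ₁/2,0,d}.
[cite: Balaban1987RG1, p.290 with (5.10) p.293] -/
theorem M0x_suppZeta_le_of_decay510 {P : B12Beta.Kernel d} {C₁ δ₁ : ℝ} (hδ : 0 < δ₁)
    (h510 : ∀ μ ν, Decay510 (P μ ν) C₁ δ₁) (μ ν : Fin d) {B : Set (Pt d)} {R₀ : ℝ}
    (SF : Finset (Pt d)) (h3 : cthickening (3 * R₀) B ⊆ ↑SF) {x : Pt d} (hx : x ∈ B) :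
    ‖M0x (ofRealK P) x μ ν - ∑ y ∈ SF, ofRealK P μ ν (x - y)‖ ≤
      C₁ * Real.exp (-(δ₁ / 2) * (3 * R₀)) * B12WholeLattice290.S (δ₁ / 2) 0 d :=
  M0x_sub_sum_le_of_decay510 hδ h510 μ ν x (3 * R₀) SF
    fun _ hy => Finset.mem_coe.1 (mem_suppZeta_of_l1_lt h3 hx hy)

/-- p.290 for the first moments of a (5.10) kernel, print's regions (x ∈ □, S ⊇ □̃³):
‖Σ_{y∈ℤᵈ} Π_{μν}(x − y)(y_κ − x_κ) − Σ_{y∈S} …‖ ≤ C₁ e^{−(δ₁/2)·3R₀} S_{δ₁/2,1,d}. [cite: Balaban1987RG1, p.290 with (5.10) p.293] -/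
theorem M1x_suppZeta_le_of_decay510 {P : B12Beta.Kernel d} {C₁ δ₁ : ℝ} (hδ : 0 < δ₁)
    (h510 : ∀ μ ν, Decay510 (P μ ν) C₁ δ₁) (μ ν κ : Fin d) {B : Set (Pt d)} {R₀ : ℝ}
    (SF : Finset (Pt d)) (h3 : cthickening (3 * R₀) B ⊆ ↑SF) {x : Pt d} (hx : x ∈ B) :
    ‖M1x (ofRealK P) x μ ν κ - ∑ y ∈ SF, ofRealK P μ ν (x - y) * ((y κ - x κ : ℤ) : ℂ)‖ ≤
      C₁ * Real.exp (-(δ₁ / 2) * (3 * R₀)) * B12WholeLattice290.S (δ₁ / 2) 1 d :=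
  M1x_sub_sum_le_of_decay510 hδ h510 μ ν κ x (3 * R₀) SF
    fun _ hy => Finset.mem_coe.1 (mem_suppZeta_of_l1_lt h3 hx hy)

/-- p.290 for the second moments of a (5.10) kernel, print's regions (x ∈ □, S ⊇ □̃³):
‖Σ_{y∈ℤᵈ} Π_{μν}(x − y)(y_κ − x_κ)(y_λ − x_λ) − Σ_{y∈S} …‖ ≤ C₁ e^{−(δ₁/2)·3R₀} S_{δ₁/2,2,d}.
[cite: Balaban1987RG1, p.290 with (5.10) p.293] -/
theorem M2x_suppZeta_le_of_decay510 {P : B12Beta.Kernel d} {C₁ δ₁ : ℝ} (hδ : 0 < δ₁)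
    (h510 : ∀ μ ν, Decay510 (P μ ν) C₁ δ₁) (μ ν κ l : Fin d) {B : Set (Pt d)} {R₀ : ℝ}
    (SF : Finset (Pt d)) (h3 : cthickening (3 * R₀) B ⊆ ↑SF) {x : Pt d} (hx : x ∈ B) :
    ‖M2x (ofRealK P) x μ ν κ l -
        ∑ y ∈ SF, ofRealK P μ ν (x - y) * (((y κ - x κ : ℤ) : ℂ) * ((y l - x l : ℤ) : ℂ))‖ ≤
      C₁ * Real.exp (-(δ₁ / 2) * (3 * R₀)) * B12WholeLattice290.S (δ₁ / 2) 2 d :=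
  M2x_sub_sum_le_of_decay510 hδ h510 μ ν κ l x (3 * R₀) SF
    fun _ hy => Finset.mem_coe.1 (mem_suppZeta_of_l1_lt h3 hx hy)

section ReplacementU

variable {W : Type*} [NormedAddCommGroup W] [NormedSpace ℂ W]

/-- **The H_j(□₀) → H_j replacement, READING (U), with print's ranges**: x ∈ □ (⊆ □̃³ ⊆ S) and y ∈ S = supp ζ̃_□
(`B12HjFree290.tsum_latt_sub_of_uniform`; δ₀ > 0, κ ≥ κ₀(4·2ᵈ, 2d)):
|Σ′_X (𝐄²₀ − 𝐄²)(X, x, y)| ≤ 8E₀α₂⁻²B₃ε K₀(4·2ᵈ, 2d) K₁(d, δ₀). [cite: Balaban1987RG1, (4.34)-(4.35) p.290] -/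
theorem tsum_latt_sub_of_uniform_box {M : ℕ} (hM : 0 < M) (EX : LDom d → W → ℂ)
    (h₀ h : LDom d → Pt d → W) (E2₀ E2 : LDom d → Pt d → Pt d → ℝ) {S B : Set (Pt d)} {R₀ : ℝ}
    {α₂ E₀ B₃ ε κ δ₀ : ℝ} (hα₂ : 0 < α₂) (hE₀ : 0 ≤ E₀) (hB₃ : 0 ≤ B₃) (hε : 0 ≤ ε) (hδ₀ : 0 < δ₀)
    (hκ₀ : kappa₀ (4 * 2 ^ d) (2 * d) ≤ κ)
    (han : ∀ X, AnalyticOnNhd ℂ (EX X) (ball 0 α₂))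
    (h118 : ∀ X, ∀ v ∈ ball (0 : W) α₂, ‖EX X v‖ ≤ E₀ * Real.exp (-κ * treeLen X.1))
    (hrepr₀ : ∀ X x y, E2₀ X x y = (mixedDeriv (EX X) (h₀ X x) (h₀ X y)).re)
    (hrepr : ∀ X x y, E2 X x y = (mixedDeriv (EX X) (h X x) (h X y)).re)
    (hh₀ : ∀ X x, ‖h₀ X x‖ ≤ B₃ * Real.exp (-δ₀ * (geomZ d M).distD x X))
    (hh : ∀ X x, ‖h X x‖ ≤ B₃ * Real.exp (-δ₀ * (geomZ d M).distD x X))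
    (hdiffU : ∀ X, ∀ x ∈ S, ‖h₀ X x - h X x‖ ≤ ε) (h3 : cthickening (3 * R₀) B ⊆ S)
    {x y : Pt d} (hx : x ∈ B) (hy : y ∈ S) :
    Summable (fun X : LDom d => E2₀ X x y - E2 X x y) ∧
    |∑' X : LDom d, (E2₀ X x y - E2 X x y)| ≤
      8 * E₀ / α₂ ^ 2 * B₃ * ε * (K₀ (4 * 2 ^ d) (2 * d) * K₁ d δ₀) :=
  tsum_latt_sub_of_uniform hM EX h₀ h E2₀ E2 hα₂ hE₀ hB₃ hε hδ₀ hκ₀ han h118 hrepr₀ hrepr hh₀ hh hdiffU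
    (box_subset_suppZeta h3 hx) hy

end ReplacementU

end Literature.MathematicalPhysics.QuantumFieldTheory.Balaban1983to89.B12Cubes436
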